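import Summits.AtomisticToContinuum.Crystallization.Theorems.OverbindingBudgetAffineRunCutForgone

/-!
# `OverbindingBudget` / crux `RobustDefectLimitWindows` (stmt-AtomisticToContinuum-31280) — «RunCut»: the scalar Taylor step of the chirality line

Support file (lens-4 g86, hand-in 3 part 0; memo `g86/memo/SW-G1.md` §9.10).  The chirality remainder must be priced at the binding end
`a = .848` (critic rows 1550/1551), and there the CONSTANTS of the third-order Taylor remainder decide: with the tree's `8|t| ≤ P` constants
(`inv_pow_six_taylor3`: 200, `inv_pow_three_taylor3`: 18) the crude remainder is ≈ 3.7e-5 per TRIPLE column at `θ₀ = 10⁻³` — on the kill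
line 4e-5 — whereas the deformation ratio actually met is `|t|/P ≤ 2‖E‖ + ‖HᵀH‖ ≲ 2.7·10⁻³`.  THIS FILE gives the SMALL-RATIO versions
(`100|t| ≤ P`; constants 62 and 21/2, within 11 % / 5 % of the sharp 56 and 10), the resulting second-order expansion of the squared-distance
Lennard-Jones profile `ljSq` (`…RunCutForgone`; `W(ρ) = ρ⁻⁶/12 − ρ⁻³/6`, `V_LJ(r) = W(r²)`) with remainder `(31/6·P⁻⁹ + 7/4·P⁻⁶)|t|³`, and the
PAIR SKELETON of the chirality expansion: for one lattice vector `r` (`|r|² = P`) and its class partner `r̄`, with `t = rᵀGr = 2u + m`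
(`G = (I+H)ᵀ(I+H) − I = 2E + HᵀH`, `u = rᵀEr`, `m = rᵀHᵀHr`),
  `W(P+t₁) − W(P+t₂) = W′(P)(t₁ − t₂) + 2W″(P)(u₁² − u₂²) + R`,  `2W″(P) = 7P⁻⁸ − 4P⁻⁵` (the weight `g` of `…RunCutChiralityKappa`),
  `|R| ≤ (31/6·P⁻⁹ + 7/4·P⁻⁶)(|t₁|³ + |t₂|³) + (7/4·P⁻⁸ + P⁻⁵)(|t₁² − 4u₁²| + |t₂² − 4u₂²|)`   (★ `ljSq_pair_expansion`),
pure scalar algebra, no lattice.  Summed over the offset coset (g87): the `W′` term has zero class difference by the first moments, the `2W″` term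
is `κ(a)·F(E)` (`tsum_weight_quadForm_sq_sub` + `kappaLJ_eq_moment`), and `R` sums against `layerTerm 1 6/3/8/5 (2/3)` with `|t| ≤ τP`,
`|t² − 4u²| ≤ (4αβθ₀³ + β²θ₀⁴)P²` — priced in `g86/numerics/chirality_remainder.py` at ≈ 1.4e-5 per TRIPLE column at `a = .848`, `θ₀ = 10⁻³`
(6.5 % of `G_T`), inside the margin of record.  [this file: 0 definitions, 4 theorems; imports `…RunCutForgone`; standard axioms]
-/

namespace Summit.AtomisticToContinuum.Crystallization.Theorems.OverbindingBudgetAffineRunCutChiralityTaylor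

open Summit.AtomisticToContinuum.Crystallization.Theorems.OverbindingBudgetAffineRunCutForgone (ljSq)

/-- **Third-order remainder of `x⁻³`, small ratio**: `|(P+t)⁻³ − P⁻³ + 3tP⁻⁴ − 6t²P⁻⁵| ≤ (21/2)|t|³P⁻⁶` for `100|t| ≤ P` (sharp constant 10;
the tree's `inv_pow_three_taylor3` gives 18 under `8|t| ≤ P`). [folklore] -/
theorem inv_pow_three_taylor3_small {P t : ℝ} (hP : 0 < P) (ht : 100 * |t| ≤ P) :
    |((P + t)⁻¹) ^ 3 - (P⁻¹) ^ 3 + 3 * t * (P⁻¹) ^ 4 - 6 * t ^ 2 * (P⁻¹) ^ 5| ≤ 21 / 2 * |t| ^ 3 * (P⁻¹) ^ 6 := by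
  have ht1 : -(P / 100) ≤ t := by linarith [neg_abs_le t]
  have ht2 : t ≤ P / 100 := by linarith [le_abs_self t]
  have hPt : 0 < P + t := by linarith
  have key : ((P + t)⁻¹) ^ 3 - (P⁻¹) ^ 3 + 3 * t * (P⁻¹) ^ 4 - 6 * t ^ 2 * (P⁻¹) ^ 5 =
      -(t ^ 3 * (10 * P ^ 2 + 15 * P * t + 6 * t ^ 2)) / (P ^ 5 * (P + t) ^ 3) := by
    field_simp
    ring
  have hden : 0 < P ^ 5 * (P + t) ^ 3 := by positivity
  have hA : |10 * P ^ 2 + 15 * P * t + 6 * t ^ 2| ≤ 254 / 25 * P ^ 2 := by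
    have m1 : P * t ≤ P * (P / 100) := mul_le_mul_of_nonneg_left ht2 hP.le
    have m1' : P * (-(P / 100)) ≤ P * t := mul_le_mul_of_nonneg_left ht1 hP.le
    have m2 : t ^ 2 ≤ (P / 100) ^ 2 := sq_le_sq' ht1 ht2
    rw [abs_le]; constructor <;> nlinarith [sq_nonneg t]
  have hD : P ^ 5 * (99 / 100 * P) ^ 3 ≤ P ^ 5 * (P + t) ^ 3 :=
    mul_le_mul_of_nonneg_left (pow_le_pow_left₀ (by positivity) (by linarith) 3) (by positivity)
  rw [key, abs_div, abs_neg, abs_mul, abs_pow, abs_of_pos hden, div_le_iff₀ hden]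
  calc |t| ^ 3 * |10 * P ^ 2 + 15 * P * t + 6 * t ^ 2| ≤ |t| ^ 3 * (254 / 25 * P ^ 2) :=
        mul_le_mul_of_nonneg_left hA (by positivity)
    _ ≤ 21 / 2 * |t| ^ 3 * (P⁻¹) ^ 6 * (P ^ 5 * (99 / 100 * P) ^ 3) := by
        have e : 21 / 2 * |t| ^ 3 * (P⁻¹) ^ 6 * (P ^ 5 * (99 / 100 * P) ^ 3) = 20376279 / 2000000 * (|t| ^ 3 * P ^ 2) := by
          field_simp
          ring
        rw [e]
        nlinarith [show 0 ≤ |t| ^ 3 * P ^ 2 by positivity]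
    _ ≤ 21 / 2 * |t| ^ 3 * (P⁻¹) ^ 6 * (P ^ 5 * (P + t) ^ 3) := mul_le_mul_of_nonneg_left hD (by positivity)

/-- **Third-order remainder of `x⁻⁶`, small ratio**: `|(P+t)⁻⁶ − P⁻⁶ + 6tP⁻⁷ − 21t²P⁻⁸| ≤ 62|t|³P⁻⁹` for `100|t| ≤ P` (sharp constant 56;
the tree's `inv_pow_six_taylor3` gives 200 under `8|t| ≤ P`). [folklore] -/
theorem inv_pow_six_taylor3_small {P t : ℝ} (hP : 0 < P) (ht : 100 * |t| ≤ P) :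
    |((P + t)⁻¹) ^ 6 - (P⁻¹) ^ 6 + 6 * t * (P⁻¹) ^ 7 - 21 * t ^ 2 * (P⁻¹) ^ 8| ≤ 62 * |t| ^ 3 * (P⁻¹) ^ 9 := by
  have h8 : |t| ≤ P / 100 := by linarith
  have ht1 : -(P / 100) ≤ t := by linarith [neg_abs_le t]
  have ht2 : t ≤ P / 100 := by linarith [le_abs_self t]
  have hPt : 0 < P + t := by linarith
  have key : ((P + t)⁻¹) ^ 6 - (P⁻¹) ^ 6 + 6 * t * (P⁻¹) ^ 7 - 21 * t ^ 2 * (P⁻¹) ^ 8 =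
      -(t ^ 3 * (56 * P ^ 5 + 210 * P ^ 4 * t + 336 * P ^ 3 * t ^ 2 + 280 * P ^ 2 * t ^ 3 +
        120 * P * t ^ 4 + 21 * t ^ 5)) / (P ^ 8 * (P + t) ^ 6) := by
    field_simp
    ring
  have hden : 0 < P ^ 8 * (P + t) ^ 6 := by positivity
  have hA : |56 * P ^ 5 + 210 * P ^ 4 * t + 336 * P ^ 3 * t ^ 2 + 280 * P ^ 2 * t ^ 3 + 120 * P * t ^ 4 + 21 * t ^ 5|
      ≤ 2907 / 50 * P ^ 5 := by
    have m2 : t ^ 2 ≤ (P / 100) ^ 2 := sq_le_sq' ht1 ht2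
    have m3 := abs_le.1 (show |t ^ 3| ≤ (P / 100) ^ 3 by rw [abs_pow]; exact pow_le_pow_left₀ (abs_nonneg t) h8 3)
    have m4 : t ^ 4 ≤ (P / 100) ^ 4 := by
      have h := pow_le_pow_left₀ (abs_nonneg t) h8 4
      rwa [Even.pow_abs ⟨2, rfl⟩] at h
    have m5 := abs_le.1 (show |t ^ 5| ≤ (P / 100) ^ 5 by rw [abs_pow]; exact pow_le_pow_left₀ (abs_nonneg t) h8 5)
    have b1 : P ^ 4 * t ≤ P ^ 4 * (P / 100) := mul_le_mul_of_nonneg_left ht2 (by positivity)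
    have b1' : P ^ 4 * (-(P / 100)) ≤ P ^ 4 * t := mul_le_mul_of_nonneg_left ht1 (by positivity)
    have b2 : P ^ 3 * t ^ 2 ≤ P ^ 3 * (P / 100) ^ 2 := mul_le_mul_of_nonneg_left m2 (by positivity)
    have b2' : 0 ≤ P ^ 3 * t ^ 2 := by positivity
    have b3 : P ^ 2 * t ^ 3 ≤ P ^ 2 * (P / 100) ^ 3 := mul_le_mul_of_nonneg_left m3.2 (by positivity)
    have b3' : P ^ 2 * (-((P / 100) ^ 3)) ≤ P ^ 2 * t ^ 3 := mul_le_mul_of_nonneg_left m3.1 (by positivity)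
    have b4 : P * t ^ 4 ≤ P * (P / 100) ^ 4 := mul_le_mul_of_nonneg_left m4 hP.le
    have b4' : 0 ≤ P * t ^ 4 := by positivity
    have hP5 : 0 < P ^ 5 := by positivity
    rw [abs_le]; constructor <;> nlinarith [m5.1, m5.2]
  have hD : P ^ 8 * (99 / 100 * P) ^ 6 ≤ P ^ 8 * (P + t) ^ 6 :=
    mul_le_mul_of_nonneg_left (pow_le_pow_left₀ (by positivity) (by linarith) 6) (by positivity)
  rw [key, abs_div, abs_neg, abs_mul, abs_pow, abs_of_pos hden, div_le_iff₀ hden]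
  calc |t| ^ 3 * |56 * P ^ 5 + 210 * P ^ 4 * t + 336 * P ^ 3 * t ^ 2 + 280 * P ^ 2 * t ^ 3 + 120 * P * t ^ 4 + 21 * t ^ 5|
        ≤ |t| ^ 3 * (2907 / 50 * P ^ 5) := mul_le_mul_of_nonneg_left hA (by positivity)
    _ ≤ 62 * |t| ^ 3 * (P⁻¹) ^ 9 * (P ^ 8 * (99 / 100 * P) ^ 6) := by
        have e : 62 * |t| ^ 3 * (P⁻¹) ^ 9 * (P ^ 8 * (99 / 100 * P) ^ 6) =
            62 * 941480149401 / 1000000000000 * (|t| ^ 3 * P ^ 5) := by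
          field_simp
          ring
        rw [e]
        nlinarith [show 0 ≤ |t| ^ 3 * P ^ 5 by positivity]
    _ ≤ 62 * |t| ^ 3 * (P⁻¹) ^ 9 * (P ^ 8 * (P + t) ^ 6) := mul_le_mul_of_nonneg_left hD (by positivity)

/-- **Second-order expansion of the squared-distance LJ profile** (`W = ljSq`, `W′ = ½(P⁻⁴ − P⁻⁷)`, `½W″ = 7/4·P⁻⁸ − P⁻⁵`), small ratio:
`|W(P+t) − W(P) − W′(P)t − ½W″(P)t²| ≤ (31/6·P⁻⁹ + 7/4·P⁻⁶)|t|³` for `100|t| ≤ P`. [this file · kind: proof] -/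
theorem ljSq_taylor2_small {P t : ℝ} (hP : 0 < P) (ht : 100 * |t| ≤ P) :
    |ljSq (P + t) - ljSq P - 1 / 2 * ((P⁻¹) ^ 4 - (P⁻¹) ^ 7) * t - (7 / 4 * (P⁻¹) ^ 8 - (P⁻¹) ^ 5) * t ^ 2|
      ≤ (31 / 6 * (P⁻¹) ^ 9 + 7 / 4 * (P⁻¹) ^ 6) * |t| ^ 3 := by
  have h6 := inv_pow_six_taylor3_small hP ht
  have h3 := inv_pow_three_taylor3_small hP ht
  have e : ljSq (P + t) - ljSq P - 1 / 2 * ((P⁻¹) ^ 4 - (P⁻¹) ^ 7) * t - (7 / 4 * (P⁻¹) ^ 8 - (P⁻¹) ^ 5) * t ^ 2 =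
      1 / 12 * (((P + t)⁻¹) ^ 6 - (P⁻¹) ^ 6 + 6 * t * (P⁻¹) ^ 7 - 21 * t ^ 2 * (P⁻¹) ^ 8)
        - 1 / 6 * (((P + t)⁻¹) ^ 3 - (P⁻¹) ^ 3 + 3 * t * (P⁻¹) ^ 4 - 6 * t ^ 2 * (P⁻¹) ^ 5) := by
    unfold ljSq
    ring
  rw [e]
  have ht3 : 0 ≤ |t| ^ 3 := by positivity
  have hP9 : 0 ≤ (P⁻¹) ^ 9 := by positivity
  have hP6 : 0 ≤ (P⁻¹) ^ 6 := by positivity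
  calc |1 / 12 * (((P + t)⁻¹) ^ 6 - (P⁻¹) ^ 6 + 6 * t * (P⁻¹) ^ 7 - 21 * t ^ 2 * (P⁻¹) ^ 8)
          - 1 / 6 * (((P + t)⁻¹) ^ 3 - (P⁻¹) ^ 3 + 3 * t * (P⁻¹) ^ 4 - 6 * t ^ 2 * (P⁻¹) ^ 5)|
        ≤ |1 / 12 * (((P + t)⁻¹) ^ 6 - (P⁻¹) ^ 6 + 6 * t * (P⁻¹) ^ 7 - 21 * t ^ 2 * (P⁻¹) ^ 8)|
          + |1 / 6 * (((P + t)⁻¹) ^ 3 - (P⁻¹) ^ 3 + 3 * t * (P⁻¹) ^ 4 - 6 * t ^ 2 * (P⁻¹) ^ 5)| := abs_sub _ _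
    _ ≤ 1 / 12 * (62 * |t| ^ 3 * (P⁻¹) ^ 9) + 1 / 6 * (21 / 2 * |t| ^ 3 * (P⁻¹) ^ 6) := by
        rw [abs_mul, abs_mul, abs_of_pos (by norm_num : (0 : ℝ) < 1 / 12), abs_of_pos (by norm_num : (0 : ℝ) < 1 / 6)]
        gcongr
    _ = (31 / 6 * (P⁻¹) ^ 9 + 7 / 4 * (P⁻¹) ^ 6) * |t| ^ 3 := by ring

/-- ★ **Pair skeleton of the chirality expansion.**  For `0 < P`, `100|t₁| ≤ P`, `100|t₂| ≤ P` and any `u₁ u₂`: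
`|W(P+t₁) − W(P+t₂) − W′(P)(t₁ − t₂) − 2W″(P)(u₁² − u₂²)| ≤ (31/6·P⁻⁹ + 7/4·P⁻⁶)(|t₁|³ + |t₂|³) + (7/4·P⁻⁸ + P⁻⁵)(|t₁² − 4u₁²| + |t₂² − 4u₂²|)`
with `2W″(P) = 7P⁻⁸ − 4P⁻⁵`.  Used with `tᵢ = 2uᵢ + mᵢ` (`uᵢ = rᵢᵀErᵢ`, `mᵢ = rᵢᵀHᵀHrᵢ`, so `tᵢ² − 4uᵢ² = 4uᵢmᵢ + mᵢ²`). [this file · kind: proof] -/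
theorem ljSq_pair_expansion {P t₁ t₂ : ℝ} (hP : 0 < P) (h₁ : 100 * |t₁| ≤ P) (h₂ : 100 * |t₂| ≤ P) (u₁ u₂ : ℝ) :
    |ljSq (P + t₁) - ljSq (P + t₂) - 1 / 2 * ((P⁻¹) ^ 4 - (P⁻¹) ^ 7) * (t₁ - t₂)
        - (7 * (P⁻¹) ^ 8 - 4 * (P⁻¹) ^ 5) * (u₁ ^ 2 - u₂ ^ 2)|
      ≤ (31 / 6 * (P⁻¹) ^ 9 + 7 / 4 * (P⁻¹) ^ 6) * (|t₁| ^ 3 + |t₂| ^ 3)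
        + (7 / 4 * (P⁻¹) ^ 8 + (P⁻¹) ^ 5) * (|t₁ ^ 2 - 4 * u₁ ^ 2| + |t₂ ^ 2 - 4 * u₂ ^ 2|) := by
  have R1 := ljSq_taylor2_small hP h₁
  have R2 := ljSq_taylor2_small hP h₂
  set k : ℝ := 7 / 4 * (P⁻¹) ^ 8 - (P⁻¹) ^ 5 with hk
  set A := ljSq (P + t₁) - ljSq P - 1 / 2 * ((P⁻¹) ^ 4 - (P⁻¹) ^ 7) * t₁ - k * t₁ ^ 2 with hA
  set B := ljSq (P + t₂) - ljSq P - 1 / 2 * ((P⁻¹) ^ 4 - (P⁻¹) ^ 7) * t₂ - k * t₂ ^ 2 with hB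
  have e : ljSq (P + t₁) - ljSq (P + t₂) - 1 / 2 * ((P⁻¹) ^ 4 - (P⁻¹) ^ 7) * (t₁ - t₂)
        - (7 * (P⁻¹) ^ 8 - 4 * (P⁻¹) ^ 5) * (u₁ ^ 2 - u₂ ^ 2)
      = A - B + k * ((t₁ ^ 2 - 4 * u₁ ^ 2) - (t₂ ^ 2 - 4 * u₂ ^ 2)) := by
    simp only [hA, hB, hk]
    ring
  rw [e]
  have hkabs : |k| ≤ 7 / 4 * (P⁻¹) ^ 8 + (P⁻¹) ^ 5 := by
    have h8 : 0 ≤ (P⁻¹) ^ 8 := by positivity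
    have h5 : 0 ≤ (P⁻¹) ^ 5 := by positivity
    rw [hk, abs_le]; constructor <;> linarith
  have hD : |(t₁ ^ 2 - 4 * u₁ ^ 2) - (t₂ ^ 2 - 4 * u₂ ^ 2)| ≤ |t₁ ^ 2 - 4 * u₁ ^ 2| + |t₂ ^ 2 - 4 * u₂ ^ 2| := abs_sub _ _
  have hkD := mul_le_mul hkabs hD (abs_nonneg _) (by positivity)
  calc |A - B + k * ((t₁ ^ 2 - 4 * u₁ ^ 2) - (t₂ ^ 2 - 4 * u₂ ^ 2))|
        ≤ |A - B| + |k * ((t₁ ^ 2 - 4 * u₁ ^ 2) - (t₂ ^ 2 - 4 * u₂ ^ 2))| := abs_add_le _ _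
    _ ≤ |A| + |B| + |k| * |(t₁ ^ 2 - 4 * u₁ ^ 2) - (t₂ ^ 2 - 4 * u₂ ^ 2)| := by
        rw [abs_mul]; linarith [abs_sub A B]
    _ ≤ _ := by nlinarith [R1, R2, hkD]

end Summit.AtomisticToContinuum.Crystallization.Theorems.OverbindingBudgetAffineRunCutChiralityTaylor
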